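import Summits.NavierStokesRegularity.NavierStokesRegularity.Theorems.AxisymmetricExtremalityAxisymmetricKatoGlobalStubSeregin2020TypeIILemma22MoserAlgebra
import Summits.NavierStokesRegularity.NavierStokesRegularity.Theorems.AxisymmetricExtremalityAxisymmetricKatoGlobalStubSeregin2020TypeIILemma22MoserCutoffs
import HarnessLib

/-!
# Seregin 2020, Lemma 2.2 (after Nazarov–Uraltseva 2012), atom M1 (`lemma22_moserStep`): the
# drift in `L³` on a parabolic cylinder, and the final constant bookkeeping

Helper toward the registered stub `lemma22_moserStep` of stmt-NavierStokesRegularity-15453 (crux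
`AxisymmetricKatoGlobal`; Seregin 2020 Lemma 2.2 ⇐ N–U 2012 Lemma 3.1). Two elementary pieces of
the reverse-Hölder step:

* `lintegral_drift_cube_le` — from the standing drift hypothesis
  `∫_{-R²}^0 (∫_{B(2R)} |U|³)^{4/3} ≤ N R²` (N–U `q = 3`, `ℓ = 4`), Hölder in time gives, on every
  cylinder `]t₁,t₀[ × B`, `B ⊆ B(2R)`, `t₀ - t₁ ≤ Θ_max ρ²`, `R ≤ 4ρ`:
  `∫∫ |U|³ ≤ Θ_max^{1/4} (16N)^{3/4} ρ²` (this is `‖b‖³_{3,3,Q}`, the isotropic drift norm used in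
  the Hölder `(3,2,6)` splitting);
* `rpow_five_thirds_final_bound` — `(K₁ d^{-2} ρ^{-2} I + K₂ d^{-6} ρ^{-2} I)^{5/3} ≤
  (K₁+K₂)^{5/3} d^{-10} ρ^{-10/3} I^{5/3}` for `0 < d ≤ 1` (the gap exponent `A = 10`).

## References

* A. I. Nazarov, N. N. Uraltseva, St. Petersburg Math. J. 23 (2012) 93–115 = arXiv:1011.1888,
  §3, Lemma 3.1, (3.3)–(3.6), Remark 5. [NazarovUraltseva2012]
* G. Seregin, Anal. Math. Phys. 10 (2020), Paper 46 = arXiv:2006.04140, Lemma 2.2. [Seregin2020]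
-/

-- the problem directory repeats the summit name (D-0017); core's `dupNamespace` linter fires
set_option linter.dupNamespace false

noncomputable section

open MeasureTheory Set Function Filter Topology Metric
open scoped NNReal ENNReal

namespace Summit.NavierStokesRegularity.NavierStokesRegularity.Theorems.AxisymmetricKatoGlobal.EulerScaling

/-! ### The drift in `L³` on a cylinder -/

/-- **`∫∫_{]t₁,t₀[×B} |U|³ ≤ Θ_max^{1/4} (16N)^{3/4} ρ²`** from the standing drift bound
`∫_{-R²}^0 (∫_{B(2R)} |U|³)^{4/3} ≤ N R²`, for `B ⊆ B(2R)`, `-R² ≤ t₁ < t₀ ≤ 0`,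
`t₀ - t₁ ≤ Θ_max ρ²`, `0 < R ≤ 4ρ` (Tonelli and Hölder `∫_I F ≤ |I|^{1/4} (∫_I F^{4/3})^{3/4}`). [cite: NazarovUraltseva2012, proof of Lemma 3.1 (the drift norm ‖b‖_{q,ℓ,Q} with q = 3, ℓ = 4, α = 1/2)] -/
theorem lintegral_drift_cube_le
    {U : ℝ → EuclideanSpace ℝ (Fin 3) → EuclideanSpace ℝ (Fin 3)}
    (hU : AEStronglyMeasurable (uncurry U) volume) {R : ℝ} {N : ℝ≥0}
    (hdrift : ∫⁻ s in Ioo (-R ^ 2) 0, (∫⁻ y in ball (0 : EuclideanSpace ℝ (Fin 3)) (2 * R),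
      ‖U s y‖ₑ ^ (3 : ℕ)) ^ (4 / 3 : ℝ) ≤ (N : ℝ≥0∞) * ENNReal.ofReal R ^ 2)
    {t₁ t₀ ρ Θmax : ℝ} (hR0 : 0 < R) (hRρ : R / 4 ≤ ρ) (ht₁ : -R ^ 2 ≤ t₁)
    (ht₀ : t₀ ≤ 0) (hΘ : 0 ≤ Θmax) (hlen : t₀ - t₁ ≤ Θmax * ρ ^ 2)
    {B : Set (EuclideanSpace ℝ (Fin 3))} (hB : B ⊆ ball (0 : EuclideanSpace ℝ (Fin 3)) (2 * R)) :
    ∫⁻ z in Ioo t₁ t₀ ×ˢ B, ‖U z.1 z.2‖ₑ ^ (3 : ℕ) ≤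
      ENNReal.ofReal (Θmax ^ ((1 : ℝ) / 4) * (16 * N) ^ ((3 : ℝ) / 4) * ρ ^ 2) := by
  have hρ : 0 < ρ := lt_of_lt_of_le (by positivity) hRρ
  set I : Set ℝ := Ioo t₁ t₀ with hI
  set Bl : Set (EuclideanSpace ℝ (Fin 3)) := ball (0 : EuclideanSpace ℝ (Fin 3)) (2 * R) with hBl
  set F : ℝ → ℝ≥0∞ := fun s => ∫⁻ y in Bl, ‖U s y‖ₑ ^ (3 : ℕ) with hF
  -- Tonelli (inequality form, no measurability needed)
  have h1 : ∫⁻ z in Ioo t₁ t₀ ×ˢ B, ‖U z.1 z.2‖ₑ ^ (3 : ℕ) ≤ ∫⁻ s in I, F s := by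
    calc ∫⁻ z in Ioo t₁ t₀ ×ˢ B, ‖U z.1 z.2‖ₑ ^ (3 : ℕ)
        ≤ ∫⁻ z in I ×ˢ Bl, ‖U z.1 z.2‖ₑ ^ (3 : ℕ) := lintegral_mono_set (prod_mono le_rfl hB)
      _ = ∫⁻ z, ‖U z.1 z.2‖ₑ ^ (3 : ℕ) ∂((volume.restrict I).prod (volume.restrict Bl)) := by
          rw [Measure.prod_restrict, ← Measure.volume_eq_prod]
      _ ≤ ∫⁻ s in I, F s := lintegral_prod_le _
  -- measurability of `F` on `I`
  have hFm : AEMeasurable F (volume.restrict I) := by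
    have hUr : AEStronglyMeasurable (uncurry U) ((volume.restrict I).prod (volume.restrict Bl)) := by
      rw [Measure.prod_restrict, ← Measure.volume_eq_prod]; exact hU.restrict
    have h := (hUr.enorm.pow_const (3 : ℕ)).lintegral_prod_right'
    exact h
  -- Hölder in time: `∫_I F ≤ |I|^{1/4} (∫_I F^{4/3})^{3/4}`
  have h2 : ∫⁻ s in I, F s ≤ (volume I) ^ ((1 : ℝ) / 4) * (∫⁻ s in I, F s ^ ((4 : ℝ) / 3)) ^ ((3 : ℝ) / 4) := by
    have hpt : ∀ s, F s = (1 : ℝ≥0∞) ^ ((1 : ℝ) / 4) * (F s ^ ((4 : ℝ) / 3)) ^ ((3 : ℝ) / 4) := by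
      intro s
      rw [ENNReal.one_rpow, one_mul, ← ENNReal.rpow_mul]; norm_num
    calc ∫⁻ s in I, F s = ∫⁻ s in I, (1 : ℝ≥0∞) ^ ((1 : ℝ) / 4) * (F s ^ ((4 : ℝ) / 3)) ^ ((3 : ℝ) / 4) :=
          lintegral_congr fun s => hpt s
      _ ≤ (∫⁻ _ in I, (1 : ℝ≥0∞)) ^ ((1 : ℝ) / 4) * (∫⁻ s in I, F s ^ ((4 : ℝ) / 3)) ^ ((3 : ℝ) / 4) :=
          ENNReal.lintegral_mul_norm_pow_le aemeasurable_const (hFm.pow_const _) (by norm_num)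
            (by norm_num) (by norm_num)
      _ = (volume I) ^ ((1 : ℝ) / 4) * (∫⁻ s in I, F s ^ ((4 : ℝ) / 3)) ^ ((3 : ℝ) / 4) := by
          rw [setLIntegral_const, one_mul]
  -- the two factors
  have hvolI : volume I ≤ ENNReal.ofReal (Θmax * ρ ^ 2) := by
    rw [hI, Real.volume_Ioo]; exact ENNReal.ofReal_le_ofReal hlen
  have hIsub : I ⊆ Ioo (-R ^ 2) 0 := fun s hs => ⟨lt_of_le_of_lt ht₁ hs.1, hs.2.trans_le ht₀⟩
  have h3 : ∫⁻ s in I, F s ^ ((4 : ℝ) / 3) ≤ (N : ℝ≥0∞) * ENNReal.ofReal R ^ 2 :=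
    (lintegral_mono_set hIsub).trans hdrift
  have h4 : (N : ℝ≥0∞) * ENNReal.ofReal R ^ 2 ≤ ENNReal.ofReal (16 * N * ρ ^ 2) := by
    have hR4 : R ≤ 4 * ρ := by linarith
    rw [← ENNReal.ofReal_pow hR0.le, ← ENNReal.ofReal_coe_nnreal, ← ENNReal.ofReal_mul N.coe_nonneg]
    refine ENNReal.ofReal_le_ofReal ?_
    have : R ^ 2 ≤ (4 * ρ) ^ 2 := pow_le_pow_left₀ hR0.le hR4 2
    nlinarith [N.coe_nonneg]
  -- assemble in `ℝ`
  have hΘρ : 0 ≤ Θmax * ρ ^ 2 := by positivity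
  have hNρ : 0 ≤ 16 * (N : ℝ) * ρ ^ 2 := by positivity
  calc ∫⁻ z in Ioo t₁ t₀ ×ˢ B, ‖U z.1 z.2‖ₑ ^ (3 : ℕ) ≤ ∫⁻ s in I, F s := h1
    _ ≤ (volume I) ^ ((1 : ℝ) / 4) * (∫⁻ s in I, F s ^ ((4 : ℝ) / 3)) ^ ((3 : ℝ) / 4) := h2
    _ ≤ ENNReal.ofReal (Θmax * ρ ^ 2) ^ ((1 : ℝ) / 4) *
          ENNReal.ofReal (16 * N * ρ ^ 2) ^ ((3 : ℝ) / 4) := by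
        gcongr
        exact h3.trans h4
    _ = ENNReal.ofReal ((Θmax * ρ ^ 2) ^ ((1 : ℝ) / 4) * (16 * N * ρ ^ 2) ^ ((3 : ℝ) / 4)) := by
        rw [ENNReal.ofReal_rpow_of_nonneg hΘρ (by norm_num),
          ENNReal.ofReal_rpow_of_nonneg hNρ (by norm_num), ← ENNReal.ofReal_mul (by positivity)]
    _ = ENNReal.ofReal (Θmax ^ ((1 : ℝ) / 4) * (16 * N) ^ ((3 : ℝ) / 4) * ρ ^ 2) := by
        congr 1
        rw [Real.mul_rpow hΘ (by positivity), Real.mul_rpow (by positivity) (by positivity),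
          show ρ ^ 2 = ρ ^ (2 : ℝ) by norm_cast, ← Real.rpow_mul hρ.le, ← Real.rpow_mul hρ.le]
        have e : ρ ^ ((2 : ℝ) * (1 / 4)) * ρ ^ ((2 : ℝ) * (3 / 4)) = ρ ^ (2 : ℝ) := by
          rw [← Real.rpow_add hρ]; norm_num
        calc Θmax ^ ((1 : ℝ) / 4) * ρ ^ ((2 : ℝ) * (1 / 4)) * ((16 * ↑N) ^ ((3 : ℝ) / 4) *
              ρ ^ ((2 : ℝ) * (3 / 4)))
            = Θmax ^ ((1 : ℝ) / 4) * (16 * ↑N) ^ ((3 : ℝ) / 4) *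
                (ρ ^ ((2 : ℝ) * (1 / 4)) * ρ ^ ((2 : ℝ) * (3 / 4))) := by ring
          _ = Θmax ^ ((1 : ℝ) / 4) * (16 * ↑N) ^ ((3 : ℝ) / 4) * ρ ^ (2 : ℝ) := by rw [e]

/-! ### The final constant bookkeeping -/

/-- **The gap exponent.** For reals `K₁, K₂ ≥ 0`, `0 < d ≤ 1`, `ρ > 0` and `I ∈ [0, ∞]`:
`(ofReal(K₁ d⁻² ρ⁻²) I + ofReal(K₂ d⁻⁶ ρ⁻²) I)^{5/3} ≤ ofReal((K₁+K₂)^{5/3} d^{-10} ρ^{-10/3}) I^{5/3}`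
(`d⁻² ≤ d⁻⁶` for `d ≤ 1`; `(c I)^{5/3} = c^{5/3} I^{5/3}`). [cite: NazarovUraltseva2012, proof of Lemma 3.1, (3.6) (the constants 2^{2ms} C₁₂)] -/
theorem rpow_five_thirds_final_bound {K₁ K₂ d ρ : ℝ} (hK₁ : 0 ≤ K₁) (hK₂ : 0 ≤ K₂) (hd : 0 < d)
    (hd1 : d ≤ 1) (hρ : 0 < ρ) (I : ℝ≥0∞) :
    (ENNReal.ofReal (K₁ * d ^ (-(2 : ℝ)) * ρ ^ (-(2 : ℝ))) * I +
        ENNReal.ofReal (K₂ * d ^ (-(6 : ℝ)) * ρ ^ (-(2 : ℝ))) * I) ^ ((5 : ℝ) / 3) ≤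
      ENNReal.ofReal ((K₁ + K₂) ^ ((5 : ℝ) / 3) * d ^ (-(10 : ℝ)) * ρ ^ (-(10 / 3 : ℝ))) *
        I ^ ((5 : ℝ) / 3) := by
  have hd2 : d ^ (-(2 : ℝ)) ≤ d ^ (-(6 : ℝ)) :=
    Real.rpow_le_rpow_of_exponent_ge hd hd1 (by norm_num)
  set c : ℝ := (K₁ + K₂) * d ^ (-(6 : ℝ)) * ρ ^ (-(2 : ℝ)) with hc
  have hc0 : 0 ≤ c := by positivity
  have hsum : ENNReal.ofReal (K₁ * d ^ (-(2 : ℝ)) * ρ ^ (-(2 : ℝ))) * I +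
      ENNReal.ofReal (K₂ * d ^ (-(6 : ℝ)) * ρ ^ (-(2 : ℝ))) * I ≤ ENNReal.ofReal c * I := by
    rw [← add_mul, ← ENNReal.ofReal_add (by positivity) (by positivity)]
    gcongr
    rw [hc]
    have hρ2 : 0 ≤ ρ ^ (-(2 : ℝ)) := Real.rpow_nonneg hρ.le _
    nlinarith [mul_le_mul_of_nonneg_left hd2 hK₁, mul_nonneg hK₁ hρ2,
      mul_le_mul_of_nonneg_right (mul_le_mul_of_nonneg_left hd2 hK₁) hρ2]
  calc (ENNReal.ofReal (K₁ * d ^ (-(2 : ℝ)) * ρ ^ (-(2 : ℝ))) * I +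
        ENNReal.ofReal (K₂ * d ^ (-(6 : ℝ)) * ρ ^ (-(2 : ℝ))) * I) ^ ((5 : ℝ) / 3)
      ≤ (ENNReal.ofReal c * I) ^ ((5 : ℝ) / 3) := ENNReal.rpow_le_rpow hsum (by norm_num)
    _ = ENNReal.ofReal (c ^ ((5 : ℝ) / 3)) * I ^ ((5 : ℝ) / 3) := by
        rw [ENNReal.mul_rpow_of_nonneg _ _ (by norm_num), ENNReal.ofReal_rpow_of_nonneg hc0 (by norm_num)]
    _ = ENNReal.ofReal ((K₁ + K₂) ^ ((5 : ℝ) / 3) * d ^ (-(10 : ℝ)) * ρ ^ (-(10 / 3 : ℝ))) *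
          I ^ ((5 : ℝ) / 3) := by
        congr 2
        rw [hc, Real.mul_rpow (by positivity) (Real.rpow_nonneg hρ.le _),
          Real.mul_rpow (by positivity) (Real.rpow_nonneg hd.le _), ← Real.rpow_mul hd.le,
          ← Real.rpow_mul hρ.le]
        norm_num

end Summit.NavierStokesRegularity.NavierStokesRegularity.Theorems.AxisymmetricKatoGlobal.EulerScaling

end
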